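import Mathlib
import HarnessLib

/-!
# Route `DeformationLadder` — crux `LowEnergyRigidity` (stmt-HubbardSuperconductivity-1892),
# crux idea `heavy-condensate-fibration`: commutator transfer through the functional calculus

Operator analysis behind the card's `SmoothCutoffBound`, for a Hermitian matrix `A = U diag(μ) U⋆`
and ANY matrix `X`:
* `hcf_norm_commutator_phase_le` — `‖[U diag(e^{iθμ}) U⋆, X]‖ ≤ |θ| ‖[A, X]‖`, proved
  ALGEBRAICALLY: `e^{iθD} = (e^{iθD/m})^m`, `[W^m,X] = Σ_j W^j[W,X]W^{m-1-j}` for a contraction `W`,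
  `e^{iθD/m} - 1 = iθD/m + O(m⁻²)` entrywise, `m → ∞`.
* `hcf_norm_commutator_cfc_le` — TRANSFER THEOREM: if `f(μᵢ) = Σ_k c_k e^{ikωμᵢ}` at the
  eigenvalues with `Σ_k |k|‖c_k‖ < ∞`, then `‖[f(A),X]‖ ≤ (|ω| Σ_k |k|‖c_k‖) ‖[A,X]‖`
  (`f(A) = Matrix.IsHermitian.cfc`), uniformly in the dimension; `hcf_norm_doubleCommutator_cfc_le`:
  `‖[f(A),[f(A),X]]‖ ≤ C_f² ‖[A,[A,X]]‖`.
With the Fourier series of a smooth plateau function this yields the smooth cutoff pair of the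
fibration with IMS budget `C_f² ‖[Π_L,[Π_L,H_L]]‖ = O(L⁻²)`.

Reference: Aleksandrov–Peller, Russian Math. Surveys 71 (2016) 605, §1.1, §3.1 (functions with
absolutely convergent Fourier expansion of `f'` are operator Lipschitz, same constant on commutators).
-/

namespace Summit.HubbardSuperconductivity.HubbardSuperconductivity.Theorems

set_option linter.dupNamespace false

open Matrix Complex Finset
open scoped Matrix.Norms.L2Operator ComplexOrder

section Transfer

variable {n : Type*} [Fintype n] [DecidableEq n]

/-- Unitary conjugation is isometric for the `ℓ²` operator norm: `‖u X u⋆‖ = ‖X‖`. [folklore] -/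
theorem hcf_norm_conjStarAlgAut (u : unitary (Matrix n n ℂ)) (X : Matrix n n ℂ) :
    ‖Unitary.conjStarAlgAut ℂ (Matrix n n ℂ) u X‖ = ‖X‖ := by
  rw [Unitary.conjStarAlgAut_apply, ← Unitary.coe_star, CStarRing.norm_mul_coe_unitary,
    CStarRing.norm_coe_unitary_mul]

/-- Conjugation of a commutator: `u (DY - YD) u⋆ = (uDu⋆)(uYu⋆) - (uYu⋆)(uDu⋆)`. [folklore] -/
theorem hcf_conjStarAlgAut_commutator (u : unitary (Matrix n n ℂ)) (D Y : Matrix n n ℂ) :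
    Unitary.conjStarAlgAut ℂ (Matrix n n ℂ) u (D * Y - Y * D) =
      Unitary.conjStarAlgAut ℂ (Matrix n n ℂ) u D * Unitary.conjStarAlgAut ℂ (Matrix n n ℂ) u Y -
        Unitary.conjStarAlgAut ℂ (Matrix n n ℂ) u Y * Unitary.conjStarAlgAut ℂ (Matrix n n ℂ) u D := by
  rw [map_sub, map_mul, map_mul]

/-- `u (u⋆ X u) u⋆ = X`. [folklore] -/
theorem hcf_conjStarAlgAut_star_mul_mul (u : unitary (Matrix n n ℂ)) (X : Matrix n n ℂ) :
    Unitary.conjStarAlgAut ℂ (Matrix n n ℂ) u (star (u : Matrix n n ℂ) * X * u) = X := by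
  rw [Unitary.conjStarAlgAut_apply]
  calc (u : Matrix n n ℂ) * (star (u : Matrix n n ℂ) * X * u) * star (u : Matrix n n ℂ)
      = ((u : Matrix n n ℂ) * star (u : Matrix n n ℂ)) * X * ((u : Matrix n n ℂ) * star (u : Matrix n n ℂ)) := by
        noncomm_ring
    _ = X := by rw [Unitary.mul_star_self_of_mem u.prop, one_mul, mul_one]

/-- **Reduction of a commutator estimate to the diagonal picture**: if `K = u D u⋆` then
`‖KX - XK‖ = ‖DY - YD‖` with `Y = u⋆ X u`. [folklore] -/
theorem hcf_norm_commutator_conj_eq (u : unitary (Matrix n n ℂ)) (D X : Matrix n n ℂ) :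
    ‖Unitary.conjStarAlgAut ℂ (Matrix n n ℂ) u D * X - X * Unitary.conjStarAlgAut ℂ (Matrix n n ℂ) u D‖ =
      ‖D * (star (u : Matrix n n ℂ) * X * u) - (star (u : Matrix n n ℂ) * X * u) * D‖ := by
  conv_lhs => rw [← hcf_conjStarAlgAut_star_mul_mul u X]
  rw [← hcf_conjStarAlgAut_commutator, hcf_norm_conjStarAlgAut]

/-- Left multiplication by powers of a contraction does not increase the norm. [folklore] -/
theorem hcf_norm_pow_mul_le {W : Matrix n n ℂ} (hW : ‖W‖ ≤ 1) (Z : Matrix n n ℂ) (j : ℕ) :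
    ‖W ^ j * Z‖ ≤ ‖Z‖ := by
  induction j with
  | zero => rw [pow_zero, one_mul]
  | succ j ih =>
    rw [pow_succ', Matrix.mul_assoc]
    calc ‖W * (W ^ j * Z)‖ ≤ ‖W‖ * ‖W ^ j * Z‖ := norm_mul_le _ _
      _ ≤ 1 * ‖Z‖ := mul_le_mul hW ih (norm_nonneg _) zero_le_one
      _ = ‖Z‖ := one_mul _

/-- Right multiplication by powers of a contraction does not increase the norm. [folklore] -/
theorem hcf_norm_mul_pow_le {W : Matrix n n ℂ} (hW : ‖W‖ ≤ 1) (Z : Matrix n n ℂ) (j : ℕ) :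
    ‖Z * W ^ j‖ ≤ ‖Z‖ := by
  induction j with
  | zero => rw [pow_zero, mul_one]
  | succ j ih =>
    rw [pow_succ, ← Matrix.mul_assoc]
    calc ‖Z * W ^ j * W‖ ≤ ‖Z * W ^ j‖ * ‖W‖ := norm_mul_le _ _
      _ ≤ ‖Z‖ * 1 := mul_le_mul ih hW (norm_nonneg _) (norm_nonneg _)
      _ = ‖Z‖ := mul_one _

/-- The telescoping identity `W^m Y - Y W^m = Σ_{j<m} W^j (WY - YW) W^{m-1-j}`. [folklore] -/
theorem hcf_pow_commutator_eq_sum (W Y : Matrix n n ℂ) (m : ℕ) :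
    W ^ m * Y - Y * W ^ m = ∑ j ∈ range m, W ^ j * (W * Y - Y * W) * W ^ (m - 1 - j) := by
  induction m with
  | zero => simp
  | succ m ih =>
    rw [sum_range_succ]
    have h0 : m + 1 - 1 - m = 0 := by omega
    rw [h0, pow_zero, mul_one]
    have hterm : ∀ j ∈ range m, W ^ j * (W * Y - Y * W) * W ^ (m + 1 - 1 - j) =
        (W ^ j * (W * Y - Y * W) * W ^ (m - 1 - j)) * W := by
      intro j hj
      have hj' := mem_range.1 hj
      rw [show m + 1 - 1 - j = (m - 1 - j) + 1 by omega, pow_succ, Matrix.mul_assoc,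
        Matrix.mul_assoc, Matrix.mul_assoc]
    rw [sum_congr rfl hterm, ← sum_mul, ← ih, pow_succ]
    noncomm_ring

/-- **`‖[W^m, Y]‖ ≤ m ‖[W, Y]‖` for a contraction `W`.** [folklore] -/
theorem hcf_norm_pow_commutator_le {W : Matrix n n ℂ} (hW : ‖W‖ ≤ 1) (Y : Matrix n n ℂ) (m : ℕ) :
    ‖W ^ m * Y - Y * W ^ m‖ ≤ m * ‖W * Y - Y * W‖ := by
  rw [hcf_pow_commutator_eq_sum]
  refine (norm_sum_le _ _).trans ?_
  calc ∑ j ∈ range m, ‖W ^ j * (W * Y - Y * W) * W ^ (m - 1 - j)‖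
      ≤ ∑ _j ∈ range m, ‖W * Y - Y * W‖ := sum_le_sum fun j _ => by
        rw [Matrix.mul_assoc]
        exact (hcf_norm_pow_mul_le hW _ j).trans (hcf_norm_mul_pow_le hW _ _)
    _ = m * ‖W * Y - Y * W‖ := by rw [sum_const, card_range, nsmul_eq_mul]

/-- Entrywise second-order expansion of the phases: for real `t` with `|t| ≤ 1`,
`‖e^{it} - 1 - it‖ ≤ t²`. [folklore] -/
theorem hcf_norm_exp_I_mul_sub_le {t : ℝ} (ht : |t| ≤ 1) :
    ‖Complex.exp (Complex.I * t) - 1 - Complex.I * t‖ ≤ t ^ 2 := by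
  have h1 : ‖Complex.I * (t : ℂ)‖ ≤ 1 := by
    rw [norm_mul, Complex.norm_I, one_mul, Complex.norm_real, Real.norm_eq_abs]
    exact ht
  have h := Complex.norm_exp_sub_one_sub_id_le h1
  rwa [norm_mul, Complex.norm_I, one_mul, Complex.norm_real, Real.norm_eq_abs, sq_abs] at h

/-- **Commutators with the unitary group of a real diagonal matrix**: for `D = diag(μ)`, `μ` real,
`‖[diag(e^{iθμ}), Y]‖ ≤ |θ| ‖[D, Y]‖`: `diag(e^{iθμ}) = W^m` with the contraction `W = diag(e^{iθμ/m})`,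
so the commutator is `≤ m‖[W - 1, Y]‖`, and `W - 1 = (iθ/m)D + R`, `‖R‖ ≤ (θΛ/m)²`; `m → ∞`. [folklore] -/
theorem hcf_norm_commutator_diagonal_phase_le (μ : n → ℝ) (θ : ℝ) (Y : Matrix n n ℂ) :
    ‖diagonal (fun i => Complex.exp (Complex.I * (θ * μ i))) * Y -
        Y * diagonal (fun i => Complex.exp (Complex.I * (θ * μ i)))‖ ≤
      |θ| * ‖diagonal (fun i => ((μ i : ℝ) : ℂ)) * Y - Y * diagonal (fun i => ((μ i : ℝ) : ℂ))‖ := by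
  set D : Matrix n n ℂ := diagonal (fun i => ((μ i : ℝ) : ℂ)) with hD
  -- a bound on the entries
  obtain ⟨Λ, hΛ0, hΛ⟩ : ∃ Λ : ℝ, 0 ≤ Λ ∧ ∀ i, |μ i| ≤ Λ := by
    refine ⟨∑ i, |μ i|, sum_nonneg fun i _ => abs_nonneg _, fun i => ?_⟩
    exact single_le_sum (f := fun i => |μ i|) (fun i _ => abs_nonneg _) (mem_univ i)
  refine le_of_forall_pos_lt_add fun ε hε => ?_
  -- choose `m` with `2 θ² Λ² ‖Y‖ / m < ε` and `|θ| Λ / m ≤ 1`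
  obtain ⟨m, hm⟩ := exists_nat_gt (max (2 * |θ| ^ 2 * Λ ^ 2 * ‖Y‖ / ε) (|θ| * Λ))
  have hm0 : (0 : ℝ) < m := lt_of_le_of_lt (le_max_of_le_right (by positivity)) hm
  have hm1 : 2 * |θ| ^ 2 * Λ ^ 2 * ‖Y‖ / ε < m := lt_of_le_of_lt (le_max_left _ _) hm
  have hm2 : |θ| * Λ < m := lt_of_le_of_lt (le_max_right _ _) hm
  have hmne : (m : ℝ) ≠ 0 := hm0.ne'
  have hm_ne : m ≠ 0 := by
    rintro rfl
    simp at hm0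
  have hmC : (m : ℂ) ≠ 0 := Nat.cast_ne_zero.2 hm_ne
  -- the contraction `W = diag(e^{iθμ/m})`
  set W : Matrix n n ℂ := diagonal (fun i => Complex.exp (Complex.I * (θ / m * μ i))) with hW
  have hWpow : W ^ m = diagonal (fun i => Complex.exp (Complex.I * (θ * μ i))) := by
    rw [hW, diagonal_pow]
    congr 1
    funext i
    rw [Pi.pow_apply, ← Complex.exp_nat_mul]
    congr 1
    field_simp
  have hWnorm : ‖W‖ ≤ 1 := by
    rw [hW, l2_opNorm_diagonal]
    refine (pi_norm_le_iff_of_nonneg zero_le_one).2 fun i => ?_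
    rw [show Complex.I * ((θ : ℂ) / (m : ℂ) * (μ i : ℂ)) = ((θ / m * μ i : ℝ) : ℂ) * Complex.I by
      push_cast; ring, Complex.norm_exp_ofReal_mul_I]
  -- `W - 1 = (iθ/m) D + R`
  set R : Matrix n n ℂ := W - 1 - ((Complex.I * (θ / m : ℝ) : ℂ)) • D with hR
  have hRdiag : R = diagonal (fun i => Complex.exp (Complex.I * ((θ / m * μ i : ℝ) : ℂ)) - 1 -
      Complex.I * ((θ / m * μ i : ℝ) : ℂ)) := by
    rw [hR, hW, hD, ← diagonal_one, ← diagonal_smul, diagonal_sub, diagonal_sub]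
    congr 1
    funext i
    simp only [Pi.smul_apply, smul_eq_mul]
    push_cast
    ring_nf
  have hRnorm : ‖R‖ ≤ (|θ| * Λ / m) ^ 2 := by
    rw [hRdiag, l2_opNorm_diagonal]
    refine (pi_norm_le_iff_of_nonneg (by positivity)).2 fun i => ?_
    have ht' : |θ / m * μ i| ≤ |θ| * Λ / m := by
      rw [abs_mul, abs_div, Nat.abs_cast]
      calc |θ| / m * |μ i| ≤ |θ| / m * Λ := by gcongr; exact hΛ i
        _ = |θ| * Λ / m := by ring
    have ht : |θ / m * μ i| ≤ 1 := ht'.trans ((div_le_one hm0).2 hm2.le)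
    refine (hcf_norm_exp_I_mul_sub_le ht).trans ?_
    rw [← sq_abs]
    exact pow_le_pow_left₀ (abs_nonneg _) ht' 2
  -- `[W, Y] = [W - 1, Y] = (iθ/m)[D, Y] + [R, Y]`
  have hcomm : W * Y - Y * W = ((Complex.I * (θ / m : ℝ) : ℂ)) • (D * Y - Y * D) + (R * Y - Y * R) := by
    rw [hR]
    simp only [sub_mul, mul_sub, smul_mul_assoc, mul_smul_comm, one_mul, mul_one, smul_sub]
    abel
  have hWY : ‖W * Y - Y * W‖ ≤ |θ| / m * ‖D * Y - Y * D‖ + 2 * (|θ| * Λ / m) ^ 2 * ‖Y‖ := by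
    rw [hcomm]
    refine (norm_add_le _ _).trans (add_le_add ?_ ?_)
    · rw [norm_smul, norm_mul, Complex.norm_I, one_mul, Complex.norm_real, Real.norm_eq_abs, abs_div,
        Nat.abs_cast]
    · calc ‖R * Y - Y * R‖ ≤ ‖R‖ * ‖Y‖ + ‖Y‖ * ‖R‖ :=
            (norm_sub_le _ _).trans (add_le_add (norm_mul_le _ _) (norm_mul_le _ _))
        _ = 2 * ‖R‖ * ‖Y‖ := by ring
        _ ≤ 2 * (|θ| * Λ / m) ^ 2 * ‖Y‖ := by gcongr
  -- assemble
  have hsmall : 2 * |θ| ^ 2 * Λ ^ 2 * ‖Y‖ / m < ε := by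
    rw [div_lt_iff₀ hm0]
    calc 2 * |θ| ^ 2 * Λ ^ 2 * ‖Y‖ = 2 * |θ| ^ 2 * Λ ^ 2 * ‖Y‖ / ε * ε := by field_simp
      _ < m * ε := mul_lt_mul_of_pos_right hm1 hε
      _ = ε * m := mul_comm _ _
  rw [← hWpow]
  calc ‖W ^ m * Y - Y * W ^ m‖ ≤ m * ‖W * Y - Y * W‖ := hcf_norm_pow_commutator_le hWnorm Y m
    _ ≤ m * (|θ| / m * ‖D * Y - Y * D‖ + 2 * (|θ| * Λ / m) ^ 2 * ‖Y‖) :=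
        mul_le_mul_of_nonneg_left hWY hm0.le
    _ = |θ| * ‖D * Y - Y * D‖ + 2 * |θ| ^ 2 * Λ ^ 2 * ‖Y‖ / m := by
        field_simp
    _ < |θ| * ‖D * Y - Y * D‖ + ε := by linarith

variable {A : Matrix n n ℂ} (hA : A.IsHermitian)

omit [Fintype n] in
/-- The real diagonal of eigenvalues, with the coercion `ℝ → ℂ` written pointwise. [folklore] -/
theorem hcf_diagonal_ofReal_eq (g : n → ℝ) :
    (diagonal (RCLike.ofReal ∘ g) : Matrix n n ℂ) = diagonal fun i => ((g i : ℝ) : ℂ) := by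
  congr 1

/-- The spectral resolution `A = U diag(μ) U⋆` (Mathlib's spectral theorem, restated with the
coercion `ℝ → ℂ` written pointwise). [folklore] -/
theorem hcf_spectral (hA : A.IsHermitian) :
    A = Unitary.conjStarAlgAut ℂ (Matrix n n ℂ) hA.eigenvectorUnitary
      (diagonal fun i => ((hA.eigenvalues i : ℝ) : ℂ)) := by
  rw [← hcf_diagonal_ofReal_eq]
  exact hA.spectral_theorem

/-- The functional calculus `f(A) = U diag(f ∘ μ) U⋆` (Mathlib's `Matrix.IsHermitian.cfc`,
restated). [folklore] -/
theorem hcf_cfc_eq_conj (f : ℝ → ℝ) :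
    hA.cfc f = Unitary.conjStarAlgAut ℂ (Matrix n n ℂ) hA.eigenvectorUnitary
      (diagonal fun i => ((f (hA.eigenvalues i) : ℝ) : ℂ)) := by
  rw [Matrix.IsHermitian.cfc, ← hcf_diagonal_ofReal_eq]
  rfl

/-- **The unitary group of `A` has commutators controlled by those of `A`**:
`‖[U diag(e^{iθμ}) U⋆, X]‖ ≤ |θ| ‖[A, X]‖` for every real `θ` and every `X`. [folklore] -/
theorem hcf_norm_commutator_phase_le (θ : ℝ) (X : Matrix n n ℂ) :
    ‖Unitary.conjStarAlgAut ℂ (Matrix n n ℂ) hA.eigenvectorUnitary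
          (diagonal fun i => Complex.exp (Complex.I * (θ * hA.eigenvalues i))) * X -
        X * Unitary.conjStarAlgAut ℂ (Matrix n n ℂ) hA.eigenvectorUnitary
          (diagonal fun i => Complex.exp (Complex.I * (θ * hA.eigenvalues i)))‖ ≤
      |θ| * ‖A * X - X * A‖ := by
  rw [hcf_norm_commutator_conj_eq]
  conv_rhs => rw [hcf_spectral hA, hcf_norm_commutator_conj_eq]
  exact hcf_norm_commutator_diagonal_phase_le hA.eigenvalues θ _

/-- Finite trigonometric sums: for `F = Σ_{k ∈ s} c_k · U diag(e^{ikωμ}) U⋆`,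
`‖[F, X]‖ ≤ (Σ_{k ∈ s} ‖c_k‖ |kω|) ‖[A, X]‖`. [folklore] -/
theorem hcf_norm_commutator_trigSum_le (c : ℤ → ℂ) (ω : ℝ) (s : Finset ℤ) (X : Matrix n n ℂ) :
    ‖(∑ k ∈ s, c k • Unitary.conjStarAlgAut ℂ (Matrix n n ℂ) hA.eigenvectorUnitary
          (diagonal fun i => Complex.exp (Complex.I * ((k : ℝ) * ω * hA.eigenvalues i)))) * X -
        X * ∑ k ∈ s, c k • Unitary.conjStarAlgAut ℂ (Matrix n n ℂ) hA.eigenvectorUnitary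
          (diagonal fun i => Complex.exp (Complex.I * ((k : ℝ) * ω * hA.eigenvalues i)))‖ ≤
      (∑ k ∈ s, ‖c k‖ * |(k : ℝ) * ω|) * ‖A * X - X * A‖ := by
  rw [sum_mul, mul_sum, ← sum_sub_distrib, sum_mul]
  refine (norm_sum_le _ _).trans (sum_le_sum fun k _ => ?_)
  rw [smul_mul_assoc, mul_smul_comm, ← smul_sub, norm_smul, mul_assoc]
  refine mul_le_mul_of_nonneg_left ?_ (norm_nonneg _)
  have h := hcf_norm_commutator_phase_le hA ((k : ℝ) * ω) X
  simp only [Complex.ofReal_mul] at h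
  exact h

/-- **TRANSFER THEOREM** (the analytic content of the card's `SmoothCutoffBound`): if
`f(μᵢ) = Σ_k c_k e^{ikωμᵢ}` at the eigenvalues of the Hermitian `A`, with `Σ_k ‖c_k‖|k| < ∞`, then
`‖f(A)X - Xf(A)‖ ≤ (|ω| Σ_k ‖c_k‖|k|) ‖AX - XA‖` for EVERY `X`, uniformly in the dimension (finite
truncations `hcf_norm_commutator_trigSum_le` + `‖f(A) - F_s‖ ≤ sup_i |f(μᵢ) - F_s(μᵢ)| → 0`).
Aleksandrov–Peller 2016 §1.1. [folklore] -/
theorem hcf_norm_commutator_cfc_le (f : ℝ → ℝ) (c : ℤ → ℂ) (ω : ℝ)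
    (hc : Summable fun k => ‖c k‖ * |(k : ℝ)|)
    (hf : ∀ i, HasSum (fun k => c k * Complex.exp (Complex.I * ((k : ℝ) * ω * hA.eigenvalues i)))
      ((f (hA.eigenvalues i) : ℝ) : ℂ))
    (X : Matrix n n ℂ) :
    ‖hA.cfc f * X - X * hA.cfc f‖ ≤ (|ω| * ∑' k, ‖c k‖ * |(k : ℝ)|) * ‖A * X - X * A‖ := by
  set U := hA.eigenvectorUnitary with hU
  set Φ := Unitary.conjStarAlgAut ℂ (Matrix n n ℂ) U with hΦ
  set e : ℤ → n → ℂ := fun k i => Complex.exp (Complex.I * ((k : ℝ) * ω * hA.eigenvalues i)) with he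
  set C : ℝ := |ω| * ∑' k, ‖c k‖ * |(k : ℝ)| with hC
  have hC0 : 0 ≤ C := mul_nonneg (abs_nonneg _) (tsum_nonneg fun k => by positivity)
  refine le_of_forall_pos_lt_add fun ε hε => ?_
  -- uniform approximation of `f` at the (finitely many) eigenvalues by a finite partial sum
  set η : ℝ := ε / (2 * ‖X‖ + 1) with hη
  have hη0 : 0 < η := by positivity
  have hpt : ∀ i, ∃ s₀ : Finset ℤ, ∀ s, s₀ ⊆ s →
      ‖((f (hA.eigenvalues i) : ℝ) : ℂ) - ∑ k ∈ s, c k * e k i‖ < η := by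
    intro i
    have h2 : Filter.Tendsto (fun s : Finset ℤ => ∑ k ∈ s, c k * e k i) Filter.atTop
        (nhds ((f (hA.eigenvalues i) : ℝ) : ℂ)) := hf i
    rw [Metric.tendsto_atTop] at h2
    obtain ⟨s₀, hs₀⟩ := h2 η hη0
    exact ⟨s₀, fun s hs => by rw [← dist_eq_norm, dist_comm]; exact hs₀ s hs⟩
  choose s₀ hs₀ using hpt
  set s : Finset ℤ := Finset.univ.biUnion s₀ with hs
  have hsi : ∀ i, ‖((f (hA.eigenvalues i) : ℝ) : ℂ) - ∑ k ∈ s, c k * e k i‖ < η := fun i =>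
    hs₀ i s (Finset.subset_biUnion_of_mem s₀ (mem_univ i))
  -- the finite partial sum as a matrix
  set Fs : Matrix n n ℂ := ∑ k ∈ s, c k • Φ (diagonal (e k)) with hFs
  set Gs : Matrix n n ℂ := diagonal fun i => ∑ k ∈ s, c k * e k i with hGs
  set G : Matrix n n ℂ := diagonal fun i => ((f (hA.eigenvalues i) : ℝ) : ℂ) with hG
  have hGs_eq : Gs = ∑ k ∈ s, c k • diagonal (e k) := by
    rw [hGs]
    have h1 : (fun i => ∑ k ∈ s, c k * e k i) = ∑ k ∈ s, c k • e k := by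
      funext i
      simp only [Finset.sum_apply, Pi.smul_apply, smul_eq_mul]
    rw [h1]
    have h2 := map_sum (diagonalLinearMap n ℂ ℂ) (fun k => c k • e k) s
    simp only [map_smul] at h2
    exact h2
  have hFs_eq : Fs = Φ Gs := by
    rw [hFs, hGs_eq, map_sum]
    refine sum_congr rfl fun k _ => ?_
    rw [map_smul]
  have hcfc : hA.cfc f = Φ G := hcf_cfc_eq_conj hA f
  -- `‖f(A) - F_s‖ ≤ η`
  have happrox : ‖hA.cfc f - Fs‖ ≤ η := by
    rw [hcfc, hFs_eq, ← map_sub, hΦ, hcf_norm_conjStarAlgAut, hG, hGs, diagonal_sub,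
      l2_opNorm_diagonal]
    refine (pi_norm_le_iff_of_nonneg hη0.le).2 fun i => ?_
    exact (hsi i).le
  -- the commutator of the finite sum
  have hfin : ‖Fs * X - X * Fs‖ ≤ C * ‖A * X - X * A‖ := by
    have h := hcf_norm_commutator_trigSum_le hA c ω s X
    refine h.trans (mul_le_mul_of_nonneg_right ?_ (norm_nonneg _))
    have habs : ∀ k : ℤ, ‖c k‖ * |(k : ℝ) * ω| = |ω| * (‖c k‖ * |(k : ℝ)|) := fun k => by
      rw [abs_mul]; ring
    simp only [habs, ← mul_sum]
    refine mul_le_mul_of_nonneg_left ?_ (abs_nonneg _)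
    exact hc.sum_le_tsum s fun k _ => by positivity
  -- split `[f(A), X] = [F_s, X] + [f(A) - F_s, X]`
  have hsplit : hA.cfc f * X - X * hA.cfc f =
      (Fs * X - X * Fs) + ((hA.cfc f - Fs) * X - X * (hA.cfc f - Fs)) := by
    noncomm_ring
  rw [hsplit]
  calc ‖Fs * X - X * Fs + ((hA.cfc f - Fs) * X - X * (hA.cfc f - Fs))‖
      ≤ ‖Fs * X - X * Fs‖ + ‖(hA.cfc f - Fs) * X - X * (hA.cfc f - Fs)‖ := norm_add_le _ _
    _ ≤ C * ‖A * X - X * A‖ + 2 * η * ‖X‖ := by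
        refine add_le_add hfin ?_
        calc ‖(hA.cfc f - Fs) * X - X * (hA.cfc f - Fs)‖
            ≤ ‖hA.cfc f - Fs‖ * ‖X‖ + ‖X‖ * ‖hA.cfc f - Fs‖ :=
              (norm_sub_le _ _).trans (add_le_add (norm_mul_le _ _) (norm_mul_le _ _))
          _ ≤ η * ‖X‖ + ‖X‖ * η := by gcongr
          _ = 2 * η * ‖X‖ := by ring
    _ < C * ‖A * X - X * A‖ + ε := by
        have hX : 0 ≤ ‖X‖ := norm_nonneg _
        have hsmall : 2 * η * ‖X‖ < ε := by
          rw [hη]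
          rw [show 2 * (ε / (2 * ‖X‖ + 1)) * ‖X‖ = ε * (2 * ‖X‖) / (2 * ‖X‖ + 1) by ring,
            div_lt_iff₀ (by positivity)]
          nlinarith
        linarith

/-- `f(A)` commutes with `A`. [folklore] -/
theorem hcf_cfc_commute (f : ℝ → ℝ) : hA.cfc f * A = A * hA.cfc f := by
  have key : Unitary.conjStarAlgAut ℂ (Matrix n n ℂ) hA.eigenvectorUnitary
        (diagonal fun i => ((f (hA.eigenvalues i) : ℝ) : ℂ)) *
      Unitary.conjStarAlgAut ℂ (Matrix n n ℂ) hA.eigenvectorUnitary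
        (diagonal fun i => ((hA.eigenvalues i : ℝ) : ℂ)) =
      Unitary.conjStarAlgAut ℂ (Matrix n n ℂ) hA.eigenvectorUnitary
        (diagonal fun i => ((hA.eigenvalues i : ℝ) : ℂ)) *
      Unitary.conjStarAlgAut ℂ (Matrix n n ℂ) hA.eigenvectorUnitary
        (diagonal fun i => ((f (hA.eigenvalues i) : ℝ) : ℂ)) := by
    rw [← map_mul, ← map_mul, diagonal_mul_diagonal, diagonal_mul_diagonal]
    congr 2
    funext i
    ring
  rw [← hcf_spectral hA] at key
  rw [hcf_cfc_eq_conj]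
  exact key

/-- **Double-commutator transfer**: `‖[f(A),[f(A),X]]‖ ≤ C_f² ‖[A,[A,X]]‖` with
`C_f = |ω| Σ_k ‖c_k‖|k|` (`f(A)` commutes with `A`, so `[A,[f(A),X]] = [f(A),[A,X]]`). [folklore] -/
theorem hcf_norm_doubleCommutator_cfc_le (f : ℝ → ℝ) (c : ℤ → ℂ) (ω : ℝ)
    (hc : Summable fun k => ‖c k‖ * |(k : ℝ)|)
    (hf : ∀ i, HasSum (fun k => c k * Complex.exp (Complex.I * ((k : ℝ) * ω * hA.eigenvalues i)))
      ((f (hA.eigenvalues i) : ℝ) : ℂ))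
    (X : Matrix n n ℂ) :
    ‖hA.cfc f * (hA.cfc f * X - X * hA.cfc f) - (hA.cfc f * X - X * hA.cfc f) * hA.cfc f‖ ≤
      (|ω| * ∑' k, ‖c k‖ * |(k : ℝ)|) ^ 2 * ‖A * (A * X - X * A) - (A * X - X * A) * A‖ := by
  set K := hA.cfc f with hK
  set C : ℝ := |ω| * ∑' k, ‖c k‖ * |(k : ℝ)| with hC
  have hC0 : 0 ≤ C := mul_nonneg (abs_nonneg _) (tsum_nonneg fun k => by positivity)
  have h1 := hcf_norm_commutator_cfc_le hA f c ω hc hf (K * X - X * K)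
  have hswap : A * (K * X - X * K) - (K * X - X * K) * A = K * (A * X - X * A) - (A * X - X * A) * K := by
    have hc' : K * A = A * K := hcf_cfc_commute hA f
    calc A * (K * X - X * K) - (K * X - X * K) * A
        = (A * K) * X - A * X * K - K * X * A + X * (K * A) := by noncomm_ring
      _ = (K * A) * X - A * X * K - K * X * A + X * (A * K) := by rw [hc']
      _ = K * (A * X - X * A) - (A * X - X * A) * K := by noncomm_ring
  rw [hswap] at h1
  have h2 := hcf_norm_commutator_cfc_le hA f c ω hc hf (A * X - X * A)
  calc ‖K * (K * X - X * K) - (K * X - X * K) * K‖ ≤ C * ‖K * (A * X - X * A) - (A * X - X * A) * K‖ := h1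
    _ ≤ C * (C * ‖A * (A * X - X * A) - (A * X - X * A) * A‖) := mul_le_mul_of_nonneg_left h2 hC0
    _ = C ^ 2 * ‖A * (A * X - X * A) - (A * X - X * A) * A‖ := by ring

end Transfer

end Summit.HubbardSuperconductivity.HubbardSuperconductivity.Theorems
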